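import Mathlib
import Summits.Ventures.PercRepro2.Defs
import Summits.Ventures.PercRepro2.Harris
import Summits.Ventures.PercRepro2.Graph
import Summits.Ventures.PercRepro2.Events
import Summits.Ventures.PercRepro2.THExtension

/-!
# Loop edges are invisible to the three-event form (blind cell PercRepro2, mine-a g49)

A loop edge `ends e₀ = s(a, a)` never enters a cluster (`openGraph_update_loop`), so the two pinnings of
`e₀` give the same probability to every cluster event (`prob_update_one_eq_update_zero`, by the involution
flipping `e₀`), the weight of `e₀` is invisible (`prob_update_eq_of_invariant`, through the pinning
identity `prob_eq_pin`), and the form `tForm` (`THExtension`) only depends on the weights of the non-loop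
edges (`tForm_update_loop`, `tForm_eq_of_loops`).  Used by `THMinor` after an edge contraction, where the
contracted edges become loops.  No instance, no notation.
-/

namespace Summit.Ventures.PercRepro2

namespace THLoops

open Finset THExtension

section Loops

variable {V E : Type*} [DecidableEq E] {R : Type*} [CommRing R]

/-- Flipping a loop edge (`ends e₀ = s(a, a)`) does not change the open graph. -/
lemma openGraph_update_loop (ends : E → Sym2 V) {e₀ : E} (hl : (ends e₀).IsDiag) (ω : Config E)
    (b : Bool) : openGraph ends (Function.update ω e₀ b) = openGraph ends ω := by
  ext u v
  rw [openGraph_adj, openGraph_adj]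
  refine and_congr_right fun huv => ⟨?_, ?_⟩
  · rintro ⟨e, he, hends⟩
    by_cases h : e = e₀
    · subst h; exact absurd (Sym2.mk_isDiag_iff.1 (hends ▸ hl)) huv
    · exact ⟨e, by rwa [Function.update_of_ne h] at he, hends⟩
  · rintro ⟨e, he, hends⟩
    by_cases h : e = e₀
    · subst h; exact absurd (Sym2.mk_isDiag_iff.1 (hends ▸ hl)) huv
    · exact ⟨e, by rwa [Function.update_of_ne h], hends⟩

/-- Cluster events are invariant under flipping a loop edge. -/
lemma mem_clusterInEvent_update_loop (ends : E → Sym2 V) {e₀ : E} (hl : (ends e₀).IsDiag)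
    (x : V) (𝓤 : Set (Set V)) (ω : Config E) (b : Bool) :
    Function.update ω e₀ b ∈ clusterInEvent ends x 𝓤 ↔ ω ∈ clusterInEvent ends x 𝓤 := by
  simp only [mem_clusterInEvent, cluster, Conn, openGraph_update_loop ends hl]

/-- Intersections of events invariant under flipping `e₀` are invariant. -/
lemma mem_inter_update_loop {A B : Set (Config E)} {e₀ : E}
    (hA : ∀ ω b, Function.update ω e₀ b ∈ A ↔ ω ∈ A)
    (hB : ∀ ω b, Function.update ω e₀ b ∈ B ↔ ω ∈ B) (ω : Config E) (b : Bool) :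
    Function.update ω e₀ b ∈ A ∩ B ↔ ω ∈ A ∩ B := by
  simp only [Set.mem_inter_iff, hA, hB]

variable [Fintype E]

/-- The weight with edge `e₀` pinned open, at `ω` reopened at `e₀`, equals the weight with `e₀`
pinned closed at `ω` closed at `e₀`. -/
lemma weight_update_one_update_true (p : E → R) (e₀ : E) {ω : Config E} (hω : ω e₀ = false) :
    weight (Function.update p e₀ 1) (Function.update ω e₀ true) =
      weight (Function.update p e₀ 0) ω := by
  rw [weight_eq_mul_edgeFactor _ _ e₀, weight_eq_mul_edgeFactor _ _ e₀, prod_erase_update_left,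
    prod_erase_update_right, prod_erase_update_left]
  simp [hω]

/-- **The two pinnings of an edge give the same probability to an event invariant under flipping
it.** -/
lemma prob_update_one_eq_update_zero (p : E → R) (e₀ : E) {A : Set (Config E)}
    (hA : ∀ ω b, Function.update ω e₀ b ∈ A ↔ ω ∈ A) :
    prob (Function.update p e₀ 1) A = prob (Function.update p e₀ 0) A := by
  classical
  rw [← prob_update_one_inter_openEdge, ← prob_update_zero_inter_closedEdge]
  unfold prob
  have hinv : Function.Involutive (fun ω : Config E => Function.update ω e₀ (!ω e₀)) := by
    intro ω; funext e; by_cases h : e = e₀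
    · subst h; simp
    · simp [Function.update_of_ne h]
  rw [← Equiv.sum_comp hinv.toPerm]
  refine sum_congr rfl fun ω _ => ?_
  simp only [Function.Involutive.coe_toPerm]
  by_cases hω : ω e₀ = true
  · have h1 : Function.update ω e₀ (!ω e₀) ∉ openEdge e₀ := by simp [openEdge, hω]
    have h2 : ω ∉ closedEdge e₀ := by simp [closedEdge, hω]
    rw [Set.indicator_of_notMem (fun h => h1 h.2), Set.indicator_of_notMem (fun h => h2 h.2)]
  · have hω' : ω e₀ = false := by simpa using hω
    have h1 : Function.update ω e₀ (!ω e₀) ∈ openEdge e₀ := by simp [openEdge, hω']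
    have h2 : ω ∈ closedEdge e₀ := by simp [closedEdge, hω']
    by_cases hAω : ω ∈ A
    · have hm1 : Function.update ω e₀ (!ω e₀) ∈ A ∩ openEdge e₀ := ⟨(hA ω _).2 hAω, h1⟩
      have hm2 : ω ∈ A ∩ closedEdge e₀ := ⟨hAω, h2⟩
      rw [Set.indicator_of_mem hm1, Set.indicator_of_mem hm2, hω']
      exact weight_update_one_update_true p e₀ hω'
    · have hm1 : Function.update ω e₀ (!ω e₀) ∉ A ∩ openEdge e₀ := fun h => hAω ((hA ω _).1 h.1)
      have hm2 : ω ∉ A ∩ closedEdge e₀ := fun h => hAω h.1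
      rw [Set.indicator_of_notMem hm1, Set.indicator_of_notMem hm2]

/-- **The weight of an edge is invisible to an event invariant under flipping it.** -/
lemma prob_update_eq_of_invariant (p : E → R) (e₀ : E) (c : R) {A : Set (Config E)}
    (hA : ∀ ω b, Function.update ω e₀ b ∈ A ↔ ω ∈ A) :
    prob (Function.update p e₀ c) A = prob p A := by
  have key := prob_update_one_eq_update_zero p e₀ hA
  rw [prob_eq_pin (Function.update p e₀ c) A e₀, prob_eq_pin p A e₀, Function.update_idem,
    Function.update_idem, Function.update_self, key]
  ring

/-- **The form does not see the weight of a loop edge.** -/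
theorem tForm_update_loop (ends : E → Sym2 V) {e₀ : E} (hl : (ends e₀).IsDiag) (p : E → R)
    (c : R) (s x : V) (𝓤 𝓥 : Set (Set V)) :
    tForm ends (Function.update p e₀ c) s x 𝓤 𝓥 = tForm ends p s x 𝓤 𝓥 := by
  have hQ := mem_clusterInEvent_update_loop ends hl s {T : Set V | x ∈ T}
  have hU := mem_clusterInEvent_update_loop ends hl s 𝓤
  have hV := mem_clusterInEvent_update_loop ends hl s 𝓥
  unfold tForm
  rw [prob_update_eq_of_invariant p e₀ c (mem_inter_update_loop (mem_inter_update_loop hQ hU) hV),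
    prob_update_eq_of_invariant p e₀ c hQ, prob_update_eq_of_invariant p e₀ c (mem_inter_update_loop hU hV),
    prob_update_eq_of_invariant p e₀ c (mem_inter_update_loop hQ hU), prob_update_eq_of_invariant p e₀ c hV,
    prob_update_eq_of_invariant p e₀ c (mem_inter_update_loop hQ hV), prob_update_eq_of_invariant p e₀ c hU]

/-- **The form only depends on the weights of the non-loop edges.** -/
theorem tForm_eq_of_loops (ends : E → Sym2 V) (p p' : E → R)
    (h : ∀ e, ¬ (ends e).IsDiag → p e = p' e) (s x : V) (𝓤 𝓥 : Set (Set V)) :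
    tForm ends p s x 𝓤 𝓥 = tForm ends p' s x 𝓤 𝓥 := by
  classical
  -- zero the weights of the loops in `S`, by induction on `S`
  have key : ∀ S : Finset E, (∀ e ∈ S, (ends e).IsDiag) →
      ∀ r : E → R, tForm ends (fun e => if e ∈ S then 0 else r e) s x 𝓤 𝓥 = tForm ends r s x 𝓤 𝓥 := by
    intro S
    induction S using Finset.induction_on with
    | empty => intro _ r; simp
    | @insert e₀ S he₀ ih =>
      intro hS r
      have hl : (ends e₀).IsDiag := hS e₀ (mem_insert_self _ _)
      have hfun : (fun e => if e ∈ insert e₀ S then (0 : R) else r e) =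
          Function.update (fun e => if e ∈ S then 0 else r e) e₀ 0 := by
        funext e; by_cases he : e = e₀
        · subst he; simp
        · simp [he]
      rw [hfun, tForm_update_loop ends hl, ih (fun e he => hS e (mem_insert_of_mem he))]
  have hp := key (univ.filter fun e => (ends e).IsDiag) (fun e he => (mem_filter.1 he).2) p
  have hp' := key (univ.filter fun e => (ends e).IsDiag) (fun e he => (mem_filter.1 he).2) p'
  rw [← hp, ← hp']
  congr 1
  funext e
  by_cases he : (ends e).IsDiag
  · simp [he]
  · simp [he, h e he]

end Loops

end THLoops

end Summit.Ventures.PercRepro2
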